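import Literature.AlgebraicGeometry.Modules.ModuleCechPerfect
import Literature.AlgebraicGeometry.Modules.CartierDivisorCechSections
import Literature.AlgebraicGeometry.Motives.CechComplexPseudoCoherentGeneralProofs
import Literature.AlgebraicGeometry.AbelianVarieties.HomogeneousLineBundleDivisor
import HarnessLib

/-!
# Finiteness of the module Čech cohomology of a line bundle on an integral closed stratum, and the
# perfectness of the module Čech complex of a line bundle on `P ×_K T` (Görtz–Wedhorn II, Thm. 23.17, Cor. 23.135)

Discharge of `Modules.StratumCechFinite` (`Modules/ModuleCechPerfect`) for a RANK-ONE `L`: on the integral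
stratum `Y = P ×_K Spec(A⧸𝔭) ↪ X = P ×_K T` (`Modules/AffineStrata`; `P` proper, geometrically integral and
flat over the field `K`, `A` noetherian) the module Čech complex of `g^*L` for the pulled-back cover `g⁻¹𝓥`
is compared — after PRUNING the members with empty trace (`Modules/ModuleCechPrune`: `prunedCechIso`),
replacing `g^*L` by `𝒪_Y(D)` (★ `AbelianVarieties/HomogeneousLineBundleDivisor`:
`exists_iso_lineBundle_toUnitCocycle`, `sectionsSystemIsoOfIso`) and reading sections of `𝒪_Y(D)` in `K(Y)`
(`Modules/CartierDivisorCechSections`: `lineBundleCechBridge_holds`) — with the ordered Čech complex of the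
coherent rank-one family `t ↦ Γ(V_t, 𝒪_Y(D)) ⊆ K(Y)` (★ `CartierDivisor.isCoherent_sectionsOn_coverData`),
whose cohomology is finitely generated over `A` by ★ `Motives/CechComplexPseudoCoherentGeneralProofs`
(`FracFamily.moduleFinite_homology_of_isCoherent` with ★ `chowFamilies`: Görtz–Wedhorn II, Thm. 23.17 /
Cor. 23.18 via Chow's lemma).

* `Modules.module_finite_homology_cechComplex_of_integral` — the finiteness on one integral closed subscheme
  of a proper scheme over an affine noetherian base;
* **`Modules.stratumCechFinite_of_hasRank_one`** — `StratumCechFinite P T 𝓥 L` for `HasRank L 1`;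
* **`Modules.module_finite_homology_cechComplex_of_hasRank_one'`**,
  **`Modules.exists_strictlyPerfect_quasiIso_cechComplex_of_hasRank_one'`** — the node's heads for line
  bundles: `Hⁱ(Č•(𝓥, L))` finitely generated over `A`, and a strictly perfect `K• → Č•(𝓥, L)` in degrees
  `[0, r]` (the Grothendieck complex; Görtz–Wedhorn II, Cor. 23.135; Mumford §5, Lemma 1; EGA III 6.10.5)
  (unprimed versions take the bridge `LineBundleCechBridge` as a hypothesis; the primed ones discharge it by
  `lineBundleCechBridge_holds`).

Everything is proved; no named facts. Mathlib searched (pin): `Scheme.Hom.isoImage`, `IsClosedImmersion`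
stability, `QuasiIso` (used); Mathlib has no finiteness theorem for coherent cohomology of proper schemes.
Cell `hodgecm-mathlib`, M13 node N1 (1a-γ) (B-p10 (g8), cut/couriered by B-p15 (g8) per B-plan1
R140/R142); generic, books 0.

## References

* U. Görtz, T. Wedhorn, *Algebraic Geometry II: Cohomology of Schemes* (2023),
  doi:10.1007/978-3-658-43031-3: Thm. 23.17 / Cor. 23.18; Thm. 23.133, Rem. 23.134, Cor. 23.135
  (pp. 354–355). [GortzWedhorn2023]
* D. Mumford, *Abelian Varieties*, TIFR Studies in Mathematics 5 (1970), §5. [MumfordAV1970]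
* A. Grothendieck, EGA III₂ (Publ. Math. IHÉS 17, 1963), (6.10.5). [EGA3]
-/

universe u

open CategoryTheory CategoryTheory.Limits AlgebraicGeometry TopologicalSpace Opposite MonoidalCategory
open CartesianMonoidalCategory TensorProduct
open Literature.AlgebraicGeometry.Motives Literature.Algebra.Homology

set_option backward.isDefEq.respectTransparency false

noncomputable section

namespace Literature.AlgebraicGeometry.Modules

/-! ### Finiteness on an integral closed subscheme of a proper scheme over an affine noetherian base -/

section Integral

variable {B Z₀ Y : Scheme.{u}} (g₀ : Z₀ ⟶ B) (ic : Y ⟶ Z₀) [IsAffine B] [IsNoetherianRing Γ(B, ⊤)]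
  [IsProper g₀] [IsLocallyNoetherian Z₀] [IsIntegral Y] [IsClosedImmersion ic]
  {ι : Type} [LinearOrder ι] [Fintype ι] (𝓦 : ι → Y.Opens) (L : Y.Modules)

/-- **Finiteness of the module Čech cohomology of a rank-one `L` on an integral closed subscheme `Y ↪ Z₀` of
a proper `Z₀ → B`, `B` affine noetherian**, over `A = Γ(B, 𝒪)` acting through `Y → Z₀ → B`, for a finite
cover of `Y` by affine opens with affine intersections, GIVEN the bridge (BR-1) (Görtz–Wedhorn II, Thm. 23.17,
via ★ `moduleFinite_homology_of_isCoherent` + ★ `chowFamilies` + ★ `isCoherent_sectionsOn_coverData`).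
[cite: GortzWedhorn2023, Thm. 23.17 and Cor. 23.18] -/
theorem module_finite_homology_cechComplex_of_integral (hbr : LineBundleCechBridge.{u})
    (haff : ∀ s : Finset ι, s.Nonempty → IsAffineOpen (cechOpen 𝓦 s)) (hcov : ⨆ i, 𝓦 i = ⊤)
    (hL : HasRank L 1) (ρ : Γ(B, ⊤) →+* Γ(Y, ⊤)) (hρ : ρ = (ic ≫ g₀).appTop.hom) (i : ℤ) :
    Module.Finite Γ(B, ⊤) ((cechComplex 𝓦 L ρ).homology i) := by
  classical
  subst hρ
  set ρ : Γ(B, ⊤) →+* Γ(Y, ⊤) := (ic ≫ g₀).appTop.hom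
  -- prune the empty members
  refine OrderedCech.module_finite_homology_of_iso (prunedCechIso 𝓦 L ρ).symm i ?_
  have hne : ∀ j : NonemptyIdx 𝓦, ((pruned 𝓦 j : Set Y)).Nonempty := fun j => j.2
  have haff' : ∀ s : Finset (NonemptyIdx 𝓦), s.Nonempty → IsAffineOpen (cechOpen (pruned 𝓦) s) := by
    intro s hs
    rw [← cechOpen_map_nonemptyEmb]
    exact haff _ (Finset.map_nonempty.2 hs)
  have hcov' : ⨆ j, pruned 𝓦 j = ⊤ := by
    apply top_unique
    rw [← hcov]
    refine iSup_le fun i => ?_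
    by_cases hi : ((𝓦 i : Set Y)).Nonempty
    · exact le_iSup (pruned 𝓦) ⟨i, hi⟩
    · rw [Set.not_nonempty_iff_eq_empty] at hi
      have : 𝓦 i = ⊥ := Opens.ext hi
      rw [this]; exact bot_le
  -- replace `L` by `𝒪_Y(D)`
  obtain ⟨D, ⟨φ⟩⟩ := exists_iso_lineBundle_toUnitCocycle hL
  refine OrderedCech.module_finite_homology_of_iso (sectionsSystemIsoOfIso (pruned 𝓦) φ ρ).symm i ?_
  -- bridge to the function-field model
  letI := ratFnAlgebra ρ
  obtain ⟨e⟩ := hbr Y Γ(B, ⊤) ρ (NonemptyIdx 𝓦) (pruned 𝓦) hne D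
  refine OrderedCech.module_finite_homology_of_iso e.symm i ?_
  -- the coherent rank-one dévissage
  have hAlg : FracFamily.AlgCompat B Z₀ g₀ Y ic := fun a => rfl
  refine FracFamily.moduleFinite_homology_of_isCoherent (B := B) (Z₀ := Z₀) (g₀ := g₀) (chowFamilies B Z₀ g₀)
    Y ic hAlg (cechCoverData (pruned 𝓦) hne haff' hcov') (cechCoverData_U_empty _ _ _ _)
    (sectionsOnFamily ρ (pruned 𝓦) D)
    (CartierDivisor.isCoherent_sectionsOn_coverData D (isRegularAt_ratFnAlgebra ρ) _) ?_ i
  -- some member is non-empty (the generic point is covered) and carries a non-zero section of `𝒪_Y(D)`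
  have hξ : genericPoint Y ∈ (⊤ : Y.Opens) := trivial
  rw [← hcov', Opens.mem_iSup] at hξ
  obtain ⟨j, -⟩ := hξ
  exact ⟨j, CartierDivisor.sectionsOn_coverData_ne_bot D (cechCoverData (pruned 𝓦) hne haff' hcov')
    (fun t a y _ => isRegularAt_ratFnAlgebra ρ a y) (Finset.singleton_nonempty j)⟩

end Integral

/-! ### The strata of `P ×_K T`; the node's heads for line bundles -/

section Strata

variable {K : Type u} [Field K] (P T : SchemeOver K) [IsAffine T.left]
variable {ι : Type} [LinearOrder ι] [Fintype ι] (𝓥 : ι → (P ⊗ T).left.Opens) (L : (P ⊗ T).left.Modules)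

/-- The structure map `A → Γ(P ×_K T_𝔭, 𝒪)` of `Modules/ModuleCechStrataBaseChange` is `(g ≫ pr_T)♯`. [folklore] [cite: GortzWedhorn2023, Thm. 23.133, proof, Step (I) (p. 354)] -/
theorem baseToStrataTotal_eq (𝔭 : PrimeSpectrum Γ(T.left, ⊤)) :
    baseToStrataTotal P T 𝔭 = (strataMap P T 𝔭 ≫ (snd P T).left).appTop.hom := by
  have hsq : strataMap P T 𝔭 ≫ (snd P T).left = (snd P (stratum T 𝔭)).left ≫ (stratumι T 𝔭).left := by
    rw [strataMap, ← Over.comp_left, whiskerLeft_snd, Over.comp_left]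
  rw [hsq, Scheme.Hom.comp_appTop]
  apply RingHom.ext
  intro a
  change stratumToTotal P T 𝔭 (baseToStratum T 𝔭 a) = (snd P (stratum T 𝔭)).left.appTop ((stratumι T 𝔭).left.appTop a)
  rw [baseToStratum_apply]

variable (hV : ∀ s : Finset ι, s.Nonempty → IsAffineOpen (cechOpen 𝓥 s)) (hcov : ⨆ i, 𝓥 i = ⊤)

include hV hcov in
/-- **`StratumCechFinite` holds for a line bundle** (`HasRank L 1`) on `P ×_K T`, `P` proper geometrically
integral (flat, universally open) over `K`, `T` affine noetherian — GIVEN the bridge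
(BR-1): each stratum `P ×_K Spec(A⧸𝔭)` is an integral closed subscheme of the proper `P ×_K T → T`, and
`module_finite_homology_cechComplex_of_integral` applies to `g^*L` (rank one) and the cover `g⁻¹𝓥`.
[cite: GortzWedhorn2023, Thm. 23.17] -/
theorem stratumCechFinite_of_hasRank_one [IsProper P.hom] [GeometricallyIntegral P.hom] [Flat P.hom]
    [UniversallyOpen P.hom] [IsNoetherianRing Γ(T.left, ⊤)]
    [IsLocallyNoetherian T.left] (hbr : LineBundleCechBridge.{u}) (hL : HasRank L 1) :
    StratumCechFinite P T 𝓥 L := by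
  intro 𝔭 i
  haveI : IsProper (snd P T).left := MorphismProperty.pullback_snd (P := @IsProper) _ _ inferInstance
  haveI : LocallyOfFiniteType (snd P T).left :=
    MorphismProperty.pullback_snd (P := @LocallyOfFiniteType) _ _ inferInstance
  haveI : IsLocallyNoetherian (P ⊗ T).left := LocallyOfFiniteType.isLocallyNoetherian (snd P T).left
  have haff : ∀ s : Finset ι, s.Nonempty → IsAffineOpen (cechOpen (strataCover P T 𝔭 𝓥) s) := by
    intro s hs
    rw [cechOpen_strataCover]
    exact isAffineOpen_preimage_whiskerLeft_stratumι T P 𝔭 (hV s hs)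
  have hcov' : ⨆ j, strataCover P T 𝔭 𝓥 j = ⊤ := by
    change ⨆ j, strataMap P T 𝔭 ⁻¹ᵁ 𝓥 j = ⊤
    rw [← Scheme.Hom.preimage_iSup, hcov, Scheme.Hom.preimage_top]
  exact module_finite_homology_cechComplex_of_integral (snd P T).left (strataMap P T 𝔭)
    (strataCover P T 𝔭 𝓥) (strataMod P T 𝔭 L) hbr haff hcov' (hasRank_pullback _ hL)
    (baseToStrataTotal P T 𝔭) (baseToStrataTotal_eq P T 𝔭) i

include hV hcov in
/-- **`Hⁱ(Č•(𝓥, L))` is a finitely generated `A`-module for a line bundle `L` on `P ×_K T`** (`T` affine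
noetherian; given the bridge (BR-1)). [cite: GortzWedhorn2023, Thm. 23.133, proof, Step (I) (p. 354)] -/
theorem module_finite_homology_cechComplex_of_hasRank_one [IsProper P.hom] [GeometricallyIntegral P.hom]
    [Flat P.hom] [UniversallyOpen P.hom] [IsNoetherianRing Γ(T.left, ⊤)]
    [IsLocallyNoetherian T.left] (hbr : LineBundleCechBridge.{u}) (hL : HasRank L 1) (i : ℤ) :
    Module.Finite Γ(T.left, ⊤) ((cechComplex 𝓥 L (baseToTotal P T)).homology i) :=
  module_finite_homology_cechComplex P T 𝓥 L hV (HasRank.isFiniteLocallyFree' hL)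
    (stratumCechFinite_of_hasRank_one P T 𝓥 L hV hcov hbr hL) i

include hV hcov in
/-- **The module Čech complex of a line bundle on `P ×_K T` over an affine noetherian `T` is strictly perfect**
(given the bridge (BR-1)): a complex `K•` of finitely generated projective `A`-modules in degrees `[0, r]`
with a quasi-isomorphism `K• → Č•(𝓥, L)` — the Grothendieck complex (Görtz–Wedhorn II, Cor. 23.135;
Mumford §5, Lemma 1; EGA III 6.10.5). [cite: GortzWedhorn2023, Cor. 23.135 (p. 355)] -/
theorem exists_strictlyPerfect_quasiIso_cechComplex_of_hasRank_one [IsProper P.hom]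
    [GeometricallyIntegral P.hom] [Flat P.hom] [UniversallyOpen P.hom]
    [IsNoetherianRing Γ(T.left, ⊤)] [IsLocallyNoetherian T.left] (hbr : LineBundleCechBridge.{u})
    (hL : HasRank L 1) (r : ℕ) (hr : (Fintype.card ι : ℤ) ≤ r + 1) :
    ∃ (K : CochainComplex (ModuleCat.{u} Γ(T.left, ⊤)) ℤ) (ψ : K ⟶ cechComplex 𝓥 L (baseToTotal P T)),
      QuasiIso ψ ∧ K.IsStrictlyGE 0 ∧ K.IsStrictlyLE (r : ℤ) ∧
      ∀ n, Module.Finite Γ(T.left, ⊤) (K.X n) ∧ Module.Projective Γ(T.left, ⊤) (K.X n) :=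
  exists_strictlyPerfect_quasiIso_cechComplex P T 𝓥 L hV (HasRank.isFiniteLocallyFree' hL)
    (stratumCechFinite_of_hasRank_one P T 𝓥 L hV hcov hbr hL) r hr

end Strata

/-! ### The node's heads, unconditional -/

section Final

variable {K : Type u} [Field K] (P T : SchemeOver K) [IsAffine T.left]
variable {ι : Type} [LinearOrder ι] [Fintype ι] (𝓥 : ι → (P ⊗ T).left.Opens) (L : (P ⊗ T).left.Modules)
variable (hV : ∀ s : Finset ι, s.Nonempty → IsAffineOpen (cechOpen 𝓥 s)) (hcov : ⨆ i, 𝓥 i = ⊤)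

include hV hcov in
/-- **`StratumCechFinite P T 𝓥 L` for a line bundle** (`HasRank L 1`) — unconditional. [cite: GortzWedhorn2023, Thm. 23.17] -/
theorem stratumCechFinite_of_hasRank_one' [IsProper P.hom] [GeometricallyIntegral P.hom] [Flat P.hom]
    [UniversallyOpen P.hom] [IsNoetherianRing Γ(T.left, ⊤)] [IsLocallyNoetherian T.left] (hL : HasRank L 1) :
    StratumCechFinite P T 𝓥 L :=
  stratumCechFinite_of_hasRank_one P T 𝓥 L hV hcov lineBundleCechBridge_holds hL

include hV hcov in
/-- **N1 (1a-γ), HEAD 1: the module Čech cohomology `Hⁱ(Č•(𝓥, L))` of a line bundle `L` on `P ×_K T` — `P`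
proper geometrically integral over the field `K`, `T` affine with noetherian (possibly non-reduced) ring `A`,
`𝓥` a finite cover of `P ×_K T` by affine opens with affine intersections — is a finitely generated `A`-module**
(Görtz–Wedhorn II, Thm. 23.133 Step (I) / Mumford §5; by dévissage over the prime strata `P ×_K Spec(A⧸𝔭)`,
base change, and the finiteness theorem Thm. 23.17 on each integral stratum).
[cite: GortzWedhorn2023, Thm. 23.133, proof, Step (I) (p. 354)] [cite: MumfordAV1970, §5, Lemma 1] -/
theorem module_finite_homology_cechComplex_of_hasRank_one' [IsProper P.hom] [GeometricallyIntegral P.hom]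
    [Flat P.hom] [UniversallyOpen P.hom] [IsNoetherianRing Γ(T.left, ⊤)] [IsLocallyNoetherian T.left]
    (hL : HasRank L 1) (i : ℤ) :
    Module.Finite Γ(T.left, ⊤) ((cechComplex 𝓥 L (baseToTotal P T)).homology i) :=
  module_finite_homology_cechComplex_of_hasRank_one P T 𝓥 L hV hcov lineBundleCechBridge_holds hL i

include hV hcov in
/-- **N1 (1a-γ), HEAD 2: the module Čech complex `Č•(𝓥, L)` of a line bundle on `P ×_K T` over an affine noetherian
`T` is strictly perfect**: there is a complex `K•` of finitely generated projective `A`-modules concentrated in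
degrees `[0, r]` (`#ι ≤ r + 1`) and a quasi-isomorphism `K• → Č•(𝓥, L)` — the Grothendieck complex of `L`
(Görtz–Wedhorn II, Cor. 23.135; Mumford, *Abelian Varieties*, §5, Lemma 1; EGA III 6.10.5), unconditional.
[cite: GortzWedhorn2023, Cor. 23.135 (p. 355)] [cite: MumfordAV1970, §5, Lemma 1] -/
theorem exists_strictlyPerfect_quasiIso_cechComplex_of_hasRank_one' [IsProper P.hom]
    [GeometricallyIntegral P.hom] [Flat P.hom] [UniversallyOpen P.hom]
    [IsNoetherianRing Γ(T.left, ⊤)] [IsLocallyNoetherian T.left]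
    (hL : HasRank L 1) (r : ℕ) (hr : (Fintype.card ι : ℤ) ≤ r + 1) :
    ∃ (K : CochainComplex (ModuleCat.{u} Γ(T.left, ⊤)) ℤ) (ψ : K ⟶ cechComplex 𝓥 L (baseToTotal P T)),
      QuasiIso ψ ∧ K.IsStrictlyGE 0 ∧ K.IsStrictlyLE (r : ℤ) ∧
      ∀ n, Module.Finite Γ(T.left, ⊤) (K.X n) ∧ Module.Projective Γ(T.left, ⊤) (K.X n) :=
  exists_strictlyPerfect_quasiIso_cechComplex_of_hasRank_one P T 𝓥 L hV hcov lineBundleCechBridge_holds hL r hr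

end Final

end Literature.AlgebraicGeometry.Modules

end
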